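import Mathlib
import HarnessLib
import Summits.HubbardSuperconductivity.HubbardSuperconductivity.Theorems.KLProgrammeKLRegimeAlphaWtBlockFlow

/-!
# K3 ENGINE child (stmt-HubbardSuperconductivity-20437), stub (b), the LEVELS package (ℓ): the block rows IN THE TOWER'S INDEXING — `hrow/hcol` of
# `klWtPinnedSumAt_klTowerIncr_le` (…EngineTowerBlockIncrWtRate: family `F̃_{dk−1}`, block `(Λ_{d(k+1)}, Λ_{dk}]`, weight `klScaleWt j`, `dk ≤ j`) at the
# flow frame `K_n`, ONE constant per `(d, d′)`

Cell `gate-hubbard-kl`, seat p3 (g11); corollary of `alphaWt_blockSliceCT_bgmFat_klEng_flow_deep` (p589530) with `nf := d·k − 1`, `J₂ := d·(k+1)`, `db := d`,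
`J′ := j`: the index arithmetic (`d·k − 1 + 1 = d·k`, `d·(k+1) ≤ d·k − 1 + 1 + d`) done once, so that E1's (I1)/(I6) cite ONE name.

* **`alphaWt_towerBlock_klEng_flow_deep (d d′)`** — `∃ Cb > 0`: stub-(b) binders + `U ≤ min (klEngU₀3 P R cc) (1/(Gfr₃+1))`, `1 ≤ n ≤ n_β+1`, `HistP … 0 n`,
  `FrameOK … K_n`, `1 ≤ d`, `1 ≤ k`, `2 ≤ d·k` (so that the family index `d·k − 1 ≥ 1`), `d·(k+1) ≤ n_β + 1`, deep window `4^{n+2}·U ≤ 4^{2(d·k−1)+d′}`,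
  `d·k ≤ j`: the `klScaleWt j`-weighted rows and columns of `S(F̃_{dk−1}[K_n])ᵀ·C^{K_n}_{(Λ_{d(k+1)},Λ_{dk}]}·S(F̃_{dk−1}[K_n])` are `≤ Cb·(M/β)/klScale klE0 (d·(k+1))`.

Everything is proved; no definitions. [cite: BenfattoGiulianiMastropietro2006, §2.8 (2.81), §3 (3.3)]
-/

noncomputable section

namespace Summit.HubbardSuperconductivity.HubbardSuperconductivity.Theorems.TorusFourierL2

set_option linter.dupNamespace false -- summit = problem name (single-conjunct summit), D-0017

open Set Finset Literature.MathematicalPhysics.QuantumLattice Literature.MathematicalPhysics.QuantumLattice.BandSectorCounting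
open Literature.MathematicalPhysics.QuantumLattice.FermiRG Literature.Probability.LatticeModels Literature.Analysis.SpecialFunctions
open Summit.HubbardSuperconductivity.HubbardSuperconductivity.Theorems.DispersionFlow
open Summit.HubbardSuperconductivity.HubbardSuperconductivity.Theorems.KLRegimeSplit
open Summit.HubbardSuperconductivity.HubbardSuperconductivity.Theorems.KLProgrammeLegKernels
open Summit.HubbardSuperconductivity.HubbardSuperconductivity.Theorems.PerturbedFermiCurve
open Summit.HubbardSuperconductivity.HubbardSuperconductivity.Theorems.KLRegimeWick
open Summit.HubbardSuperconductivity.HubbardSuperconductivity.Theorems.EngineV8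
open scoped Real Nat

open Classical

/-- **The block rows in the tower's indexing** (see the module docstring): `alphaWt_blockSliceCT_bgmFat_klEng_flow_deep d d′` at `nf := d·k − 1`,
`J₂ := d·(k+1)`, `J′ := j`. [cite: BenfattoGiulianiMastropietro2006, §2.8 (2.81), §3 (3.3)] -/
theorem alphaWt_towerBlock_klEng_flow_deep (d dd : ℕ) :
    ∃ Cb : ℝ, 0 < Cb ∧
      ∀ (G : GeoConsts) (P : SplitConsts) (R : RenConsts) (Q : EngConsts) (cc : ℝ), R.WF2 → 0 < cc → cc ≤ EngineV8.klEngC₃6 P R →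
      ∀ μ ∈ klWindowC, ∀ U : ℝ, 0 < U → U ≤ min (EngineV8.klEngU₀3 P R cc) (1 / (R.Gfr 3 + 1)) →
      ∀ β : ℝ, klBetaMin ≤ β → β ≤ Real.exp (cc / U ^ 2) →
      ∀ (L M : ℕ) [NeZero L] [NeZero M], EngineV8.klEngL₃ β U ≤ L → EngineV8.klEngM₃ β U L ≤ M →
      ∀ n : ℕ, 1 ≤ n → n ≤ nScales β + 1 →
        HistP klPredsV17F2 L M G P Q R β U μ 0 n → FrameOK R U (nScales β) μ (klFlowFrameU L M β U μ n) →
        ∀ k : ℕ, 1 ≤ k → 2 ≤ d * k → d * (k + 1) ≤ nScales β + 1 →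
        (4 : ℝ) ^ (n + 2) * U ≤ (4 : ℝ) ^ (2 * (d * k - 1) + dd) → ∀ j : ℕ, d * k ≤ j →
        (∀ Y : SpaceTimeIdx L M × SectorLeg (sectorCount (d * k - 1)),
          ∑ Y', ‖((sectorSubMatrix L M β (bgmFatMultiplier L M klE0 β (nambuXiCT L μ (klFlowFrameU L M β U μ n)) (d * k - 1))).transpose *
            hubbardCovSliceCT L M β μ 0 (klFlowFrameU L M β U μ n) (klScale klE0 (d * (k + 1))) (klScale klE0 (d * k)) *
            sectorSubMatrix L M β (bgmFatMultiplier L M klE0 β (nambuXiCT L μ (klFlowFrameU L M β U μ n)) (d * k - 1))) Y Y'‖ *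
              EngineV8.klScaleWt L M β j {EngineV8.latticeLegPos (2 * (2 * M)) Y, EngineV8.latticeLegPos (2 * (2 * M)) Y'} ≤
            Cb * ((M : ℝ) / β) / klScale klE0 (d * (k + 1))) ∧
        (∀ Y' : SpaceTimeIdx L M × SectorLeg (sectorCount (d * k - 1)),
          ∑ Y, ‖((sectorSubMatrix L M β (bgmFatMultiplier L M klE0 β (nambuXiCT L μ (klFlowFrameU L M β U μ n)) (d * k - 1))).transpose *
            hubbardCovSliceCT L M β μ 0 (klFlowFrameU L M β U μ n) (klScale klE0 (d * (k + 1))) (klScale klE0 (d * k)) *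
            sectorSubMatrix L M β (bgmFatMultiplier L M klE0 β (nambuXiCT L μ (klFlowFrameU L M β U μ n)) (d * k - 1))) Y Y'‖ *
              EngineV8.klScaleWt L M β j {EngineV8.latticeLegPos (2 * (2 * M)) Y, EngineV8.latticeLegPos (2 * (2 * M)) Y'} ≤
            Cb * ((M : ℝ) / β) / klScale klE0 (d * (k + 1))) := by
  obtain ⟨Cb, hCb, h⟩ := alphaWt_blockSliceCT_bgmFat_klEng_flow_deep d dd
  refine ⟨Cb, hCb, ?_⟩
  intro G P R Q cc hR2 hcc hcc6 μ hμ U hU hUle β hβmin hβc L M _ _ hL3 hM3 n hn1 hnN hhist hfr k hk hdk hkN hwin j hj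
  have e1 : d * k - 1 + 1 = d * k := by omega
  have h' := h G P R Q cc hR2 hcc hcc6 μ hμ U hU hUle β hβmin hβc L M hL3 hM3 n hn1 hnN hhist hfr (d * k - 1) (by omega) (d * (k + 1))
    (by rw [e1]; exact Nat.mul_le_mul_left d (Nat.le_succ k)) (by rw [e1, Nat.mul_succ]) hkN hwin j (by omega)
  rw [e1] at h'
  exact h'

end Summit.HubbardSuperconductivity.HubbardSuperconductivity.Theorems.TorusFourierL2

end
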